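import Mathlib
import HarnessLib
import Summits.Ventures.LatticeQCDFlow.Scoring.BlockStatisticsCeilingFree

/-!
# The reweighting (importance-sampling) column WITHOUT a weight ceiling: the median over `R`
# blocks of the block estimates `Σ_j w_j O_j / m` of `E_p O` is within `t` of it with probability
# `≥ 1 − e^{−R/8}` as soon as `4‖O‖²_∞ M₂ ≤ m t²` — the effective sample size is the only input

HONEST FRAMING: exact (Metropolis-corrected) sampling algorithms for lattice gauge theory;
figures of merit are autocorrelation/cost numbers at stated couplings and volumes; no
continuum-physics claim.

Venture `LatticeQCDFlow` (cell pub-lqcd), topic `Scoring`; FANOUT row 4 (`s0-u1-b`, rung S0-B).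
A flow sampler reports observables either along its exact IMH chain or by REWEIGHTING its i.i.d.
proposals: `Ê = Σ_j w(y_j) O(y_j) / m`, `w = p/q`, unbiased for `E_p O = ∫ p·O dμ`, with variance
`Var_q(wO)/m ≤ ‖O‖²_∞ M₂/m`, `M₂ = ∫ p²/q dμ = 1/ESS`.  The tree's exponential certificates for
reweighting are chain-side and need bounded summands (`Scoring/RatioEstimatorConfidence`, Doeblin);
for i.i.d. proposals an exponential tail of `Ê` itself needs a weight ceiling.  As for the
acceptance column (`Scoring/AllPairsAcceptanceCeilingFree`), the MEDIAN OF BLOCKS removes the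
ceiling: the classical median-of-means estimator (Nemirovsky–Yudin 1983; Devroye–Lerasle–Lugosi–
Oliveira, Ann. Statist. 44 (2016); Lugosi–Mendelson, Found. Comput. Math. 19 (2019) §2 — printed
counterparts NAMED ONLY) applied to ONE proposal stream cut into `R` disjoint blocks of `m` draws:
Chebyshev per block (`Var_ν g/(m t²) ≤ 1/4`), independence of the blocks (grouping,
`AllPairsMedian.iIndepFun_blockFun`), and row 4's finite-index device
`BlockMedian.measureReal_half_far_le`.  NEW WORK of the cell (elementary); no definition is
introduced; nothing is cited as a fact.  The only analytic input is `p²/q ∈ L¹(μ)` (stated as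
`Integrable` — no junk Bochner bound) and a sup bound `|O| ≤ B`.

## Content (`ν = μ.withDensity q`; `w = p/q`; `M₂ = ∫ p²/q dμ`; block `r` = draws `rm, …, rm + m − 1`)

* §1 any square-integrable `g` under the common law `ν` of the draws:
  **`blockMean_chebyshev_iid`** — `m ≥ 1` i.i.d. draws, `u > 0`:
  `P(u ≤ |Σ_j g(x_j)/m − ∫ g dν|) ≤ Var_ν g/(m u²)`;
  **`blockMean_medianOfBlocks_confidence`** — `R·m ≤ n`, `t > 0`, `4 Var_ν g ≤ m t²`:
  `P( #{r < R : t ≤ |Ḡ_r − ∫ g dν|} ≥ R/2 ) ≤ exp(−R/8)`;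
  `blockMean_sampleMedian_confidence` — the same for ANY sample-median selection `med(ω)`:
  `P(t ≤ |med − ∫ g dν|) ≤ exp(−R/8)`.
* §2 the reweighting estimator (`g = w·O`, `|O| ≤ B` measurable): `integral_weightMul_model`
  (`∫ wO dν = ∫ p·O dμ`), `memLp_weightMul_model`, `variance_weightMul_model_le`
  (`Var_ν(wO) ≤ B² M₂`), **`reweighting_medianOfBlocks_confidence`** (`4B²M₂ ≤ m t²` ⇒ `e^{−R/8}`)
  and **`reweighting_sampleMedian_confidence`**.

Reading (value-free): `R ≈ 8 log(1/η)` blocks of `m` proposals each certify a bounded observable's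
reweighted estimate to `± 2B√(M₂/m) = ± 2B/√(m·ESS)` at confidence `1 − η`, for every flow with a
positive effective sample size and no ceiling.  NOT CLAIMED: the self-normalised ratio
`Σ w̃O/Σ w̃` (add the mean-weight Chebyshev of `Scoring/BlockStatisticsCeilingFree` and a ratio
step, as in `Scoring/AllPairsAcceptanceRatioCeilingFree`); unbounded observables (replace `B²M₂` by
`∫ (p²/q) O² dμ`, which is what the proof uses); estimating `M₂`; any number of ours re-scored.
-/

noncomputable section

namespace Summit.Ventures.LatticeQCDFlow.Scoring.ReweightingMedian

open MeasureTheory ProbabilityTheory Finset Real Set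
open Summit.Ventures.LatticeQCDFlow.Scoring.BlockMedian
open Summit.Ventures.LatticeQCDFlow.Scoring.AllPairsMedian

/-! ## §1 Median of block means of a square-integrable function of i.i.d. draws -/

section BlockMean

variable {Ω : Type*} [MeasurableSpace Ω] {P : Measure Ω} [IsProbabilityMeasure P]
variable {X : Type*} [MeasurableSpace X] {ν : Measure X} {n m R : ℕ}

/-- **CHEBYSHEV FOR A BLOCK MEAN of `m ≥ 1` i.i.d. draws**: `g ∈ L²(ν)` measurable, `u > 0` ⇒
`P(u ≤ |Σ_j g(x_j)/m − ∫ g dν|) ≤ Var_ν g/(m u²)`. [ours] -/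
theorem blockMean_chebyshev_iid {x : Fin m → Ω → X} (hxm : ∀ j, Measurable (x j))
    (hind : iIndepFun x P) (hlaw : ∀ j, Measure.map (x j) P = ν) {g : X → ℝ} (hgm : Measurable g)
    (hg2 : MemLp g 2 ν) (hm : 1 ≤ m) {u : ℝ} (hu : 0 < u) :
    P.real {ω | u ≤ |(∑ j : Fin m, g (x j ω)) / m - ∫ a, g a ∂ν|} ≤ Var[g; ν] / (m * u ^ 2) := by
  haveI hν : IsProbabilityMeasure ν := isProbabilityMeasure_of_map_eq_iid (hxm ⟨0, hm⟩) (hlaw ⟨0, hm⟩)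
  -- the variables `g ∘ x_j`: square-integrable, mean `∫ g dν`, variance `Var_ν g`, independent
  have hw2 : ∀ j, MemLp (fun ω => g (x j ω)) 2 P := fun j => by
    have hw : MemLp g 2 (Measure.map (x j) P) := by rw [hlaw]; exact hg2
    exact hw.comp_of_map (hxm j).aemeasurable
  have hmean : ∀ j, ∫ ω, g (x j ω) ∂P = ∫ a, g a ∂ν := fun j => by
    have h := integral_map (μ := P) (hxm j).aemeasurable (f := g) hgm.aestronglyMeasurable
    rw [hlaw] at h
    exact h.symm
  have hvar : ∀ j, Var[fun ω => g (x j ω); P] = Var[g; ν] := fun j => by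
    have h := variance_map (μ := P) (X := g) (Y := x j) (by rw [hlaw]; exact hgm.aemeasurable)
      (hxm j).aemeasurable
    rw [hlaw] at h
    exact h.symm
  have hind' : iIndepFun (fun j ω => g (x j ω)) P := hind.comp (fun _ => g) fun _ => hgm
  -- the sum: variance `m Var_ν g`, mean `m ∫ g`
  have hS2 : MemLp (fun ω => ∑ j : Fin m, g (x j ω)) 2 P := memLp_finsetSum _ fun j _ => hw2 j
  have hvarS : Var[fun ω => ∑ j : Fin m, g (x j ω); P] = m * Var[g; ν] := by
    have h := IndepFun.variance_sum (μ := P) (X := fun j ω => g (x j ω))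
      (s := (univ : Finset (Fin m))) (fun j _ => hw2 j) fun i _ j _ hij => hind'.indepFun hij
    rw [Finset.sum_fn] at h
    rw [h, Finset.sum_congr rfl fun j _ => hvar j, sum_const, card_univ, Fintype.card_fin,
      nsmul_eq_mul]
  have hmeanS : ∫ ω, ∑ j : Fin m, g (x j ω) ∂P = (m : ℝ) * ∫ a, g a ∂ν := by
    rw [integral_finsetSum _ fun j _ => (hw2 j).integrable one_le_two,
      Finset.sum_congr rfl fun j _ => hmean j, sum_const, card_univ, Fintype.card_fin,
      nsmul_eq_mul]
  -- the mean: `E = ∫ g`, `E(Ḡ − ∫ g)² = Var Ḡ = Var_ν g / m`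
  have hm0 : (0 : ℝ) < m := by exact_mod_cast hm
  have hWeq : (fun ω => (∑ j : Fin m, g (x j ω)) / m)
      = fun ω => (m : ℝ)⁻¹ * ∑ j : Fin m, g (x j ω) := by
    funext ω; rw [div_eq_inv_mul]
  have hW2 : MemLp (fun ω => (∑ j : Fin m, g (x j ω)) / m) 2 P := by
    rw [hWeq]; exact hS2.const_mul _
  have hmeanW : ∫ ω, (∑ j : Fin m, g (x j ω)) / m ∂P = ∫ a, g a ∂ν := by
    simp_rw [div_eq_inv_mul _ (m : ℝ)]
    rw [integral_const_mul, hmeanS, ← mul_assoc, inv_mul_cancel₀ hm0.ne', one_mul]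
  have hvarW : Var[fun ω => (∑ j : Fin m, g (x j ω)) / m; P] = Var[g; ν] / m := by
    rw [hWeq, variance_const_mul, hvarS]
    field_simp
  have hsq : ∫ ω, ((∑ j : Fin m, g (x j ω)) / m - ∫ a, g a ∂ν) ^ 2 ∂P = Var[g; ν] / m := by
    rw [← hvarW, variance_eq_integral hW2.aestronglyMeasurable.aemeasurable]
    exact integral_congr_ae (Filter.Eventually.of_forall fun ω => by rw [hmeanW])
  calc P.real {ω | u ≤ |(∑ j : Fin m, g (x j ω)) / m - ∫ a, g a ∂ν|}
      ≤ (∫ ω, ((∑ j : Fin m, g (x j ω)) / m - ∫ a, g a ∂ν) ^ 2 ∂P) / u ^ 2 :=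
        measureReal_abs_sub_ge_le hW2 _ hu
    _ = Var[g; ν] / (m * u ^ 2) := by rw [hsq, div_div]

/-- **MEDIAN OF BLOCK MEANS (median-of-means for ONE i.i.d. stream), no boundedness.**  `n`
independent draws `y_j` with common law `ν`, `g ∈ L²(ν)` measurable, `m ≥ 1`, `R·m ≤ n`, `t > 0`
with `4 Var_ν g ≤ m t²`; `Ḡ_r = Σ_{j<m} g(y_{rm+j})/m`:
`P( #{r < R : t ≤ |Ḡ_r − ∫ g dν|} ≥ R/2 ) ≤ exp(−R/8)`. [ours] -/
theorem blockMean_medianOfBlocks_confidence {y : Fin n → Ω → X} (hym : ∀ j, Measurable (y j))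
    (hind : iIndepFun y P) (hlaw : ∀ j, Measure.map (y j) P = ν) {g : X → ℝ} (hgm : Measurable g)
    (hg2 : MemLp g 2 ν) (hm : 1 ≤ m) (hRm : R * m ≤ n) {t : ℝ} (ht : 0 < t)
    (hvt : 4 * Var[g; ν] ≤ m * t ^ 2) :
    P.real {ω | (R : ℝ) / 2 ≤ #{r ∈ (univ : Finset (Fin R)) | t ≤
        |(∑ j : Fin m, g (y ⟨((r : Fin R) : ℕ) * m + j, mul_add_lt hRm r j⟩ ω)) / m
          - ∫ a, g a ∂ν|}} ≤ exp (-(R / 8)) := by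
  have hm0 : (0 : ℝ) < m := by exact_mod_cast hm
  have hg' : Measurable fun (v : Fin m → X) => (∑ j : Fin m, g (v j)) / (m : ℝ) :=
    (Finset.measurable_sum _ fun (j : Fin m) _ => hgm.comp (measurable_pi_apply j)).div_const _
  have hYind : iIndepFun (fun (r : Fin R) ω =>
      (∑ j : Fin m, g (y ⟨(r : ℕ) * m + j, mul_add_lt hRm r j⟩ ω)) / (m : ℝ)) P :=
    iIndepFun_blockFun hym hind hRm hg'
  have hYm : ∀ r : Fin R, Measurable fun ω =>
      (∑ j : Fin m, g (y ⟨(r : ℕ) * m + j, mul_add_lt hRm r j⟩ ω)) / (m : ℝ) := fun r => by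
    have hblk : Measurable fun ω => fun (i : Fin m) => y ⟨(r : ℕ) * m + i, mul_add_lt hRm r i⟩ ω :=
      measurable_pi_lambda _ fun i => hym _
    exact hg'.comp hblk
  have hfar : ∀ r ∈ (univ : Finset (Fin R)), P.real {ω | t ≤
      |(∑ j : Fin m, g (y ⟨(r : ℕ) * m + j, mul_add_lt hRm r j⟩ ω)) / m - ∫ a, g a ∂ν|}
        ≤ 1 / 4 := by
    intro r _
    refine (blockMean_chebyshev_iid (x := fun (i : Fin m) => y ⟨(r : ℕ) * m + i, mul_add_lt hRm r i⟩)
      (fun i => hym _) (iIndepFun_block hind hRm r) (fun i => hlaw _) hgm hg2 hm ht).trans ?_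
    rw [div_le_iff₀ (by positivity)]
    linarith
  have h := measureReal_half_far_le (μ := P) (univ : Finset (Fin R)) hYind hYm (∫ a, g a ∂ν) t
    hfar
  simpa only [card_univ, Fintype.card_fin] using h

/-- **The same for ANY sample-median selection** `med(ω)` of the `R` block means (at least half
`≥ med ω`, at least half `≤ med ω`): `P(t ≤ |med − ∫ g dν|) ≤ exp(−R/8)`. [ours] -/
theorem blockMean_sampleMedian_confidence {y : Fin n → Ω → X} (hym : ∀ j, Measurable (y j))
    (hind : iIndepFun y P) (hlaw : ∀ j, Measure.map (y j) P = ν) {g : X → ℝ} (hgm : Measurable g)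
    (hg2 : MemLp g 2 ν) (hm : 1 ≤ m) (hRm : R * m ≤ n) {t : ℝ} (ht : 0 < t)
    (hvt : 4 * Var[g; ν] ≤ m * t ^ 2) {med : Ω → ℝ}
    (hlo : ∀ ω, (R : ℝ) / 2 ≤ #{r ∈ (univ : Finset (Fin R)) | med ω ≤
        (∑ j : Fin m, g (y ⟨((r : Fin R) : ℕ) * m + j, mul_add_lt hRm r j⟩ ω)) / m})
    (hhi : ∀ ω, (R : ℝ) / 2 ≤ #{r ∈ (univ : Finset (Fin R)) |
        (∑ j : Fin m, g (y ⟨((r : Fin R) : ℕ) * m + j, mul_add_lt hRm r j⟩ ω)) / m ≤ med ω}) :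
    P.real {ω | t ≤ |med ω - ∫ a, g a ∂ν|} ≤ exp (-(R / 8)) := by
  refine (measureReal_mono ?_).trans
    (blockMean_medianOfBlocks_confidence hym hind hlaw hgm hg2 hm hRm ht hvt)
  intro ω hω
  simp only [Set.mem_setOf_eq] at hω ⊢
  by_contra hlt
  push Not at hlt
  have hR : (#(univ : Finset (Fin R)) : ℝ) = R := by rw [card_univ, Fintype.card_fin]
  have h := abs_median_sub_lt_of_card_lt (univ : Finset (Fin R)) _ (hR ▸ hlo ω) (hR ▸ hhi ω)
    (hR ▸ hlt)
  linarith

end BlockMean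

/-! ## §2 The reweighting estimator of a bounded observable, ceiling-free -/

section Reweighting

variable {Ω : Type*} [MeasurableSpace Ω] {P : Measure Ω} [IsProbabilityMeasure P]
variable {X : Type*} [MeasurableSpace X] {μ : Measure X} {p q O : X → ℝ} {n m R : ℕ}

/-- `∫ w·O d(q dμ) = ∫ p·O dμ = E_p O` (dictionary; `(p/q)·O·q = p·O`). [ours] -/
theorem integral_weightMul_model (hq0 : ∀ z, 0 < q z) (hqm : Measurable q) :
    ∫ a, p a / q a * O a ∂(μ.withDensity fun z => ENNReal.ofReal (q z)) = ∫ z, p z * O z ∂μ := by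
  rw [AllPairsVariance.integral_withDensity_eq' (fun z => (hq0 z).le) hqm]
  refine integral_congr_ae (Filter.Eventually.of_forall fun a => ?_)
  show p a / q a * O a * q a = p a * O a
  field_simp [(hq0 a).ne']

/-- **`w·O ∈ L²(q dμ)`** for `|O| ≤ B` measurable and `p²/q ∈ L¹(μ)`: `(wO)²·q = (p²/q)·O² ≤ B²·p²/q`.
[ours] -/
theorem memLp_weightMul_model (hpm : Measurable p) (hq0 : ∀ z, 0 < q z) (hqm : Measurable q)
    (hM2i : Integrable (fun z => p z ^ 2 / q z) μ) (hOm : Measurable O) {B : ℝ}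
    (hOB : ∀ z, |O z| ≤ B) :
    MemLp (fun a => p a / q a * O a) 2 (μ.withDensity fun z => ENNReal.ofReal (q z)) := by
  have hfm : Measurable (fun a => p a / q a * O a) := (hpm.div hqm).mul hOm
  rw [memLp_two_iff_integrable_sq hfm.aestronglyMeasurable,
    AllPairsVariance.integrable_withDensity_iff' (fun z => (hq0 z).le) hqm]
  have h : (fun a => (p a / q a * O a) ^ 2 * q a) = fun a => p a ^ 2 / q a * O a ^ 2 := by
    funext a
    field_simp [(hq0 a).ne']
  rw [h]
  refine Integrable.mono' (hM2i.mul_const (B ^ 2)) (((hpm.pow_const 2).div hqm).mul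
    (hOm.pow_const 2)).aestronglyMeasurable (Filter.Eventually.of_forall fun a => ?_)
  have hpq : 0 ≤ p a ^ 2 / q a := div_nonneg (sq_nonneg _) (hq0 a).le
  rw [Real.norm_eq_abs, abs_of_nonneg (mul_nonneg hpq (sq_nonneg _))]
  refine mul_le_mul_of_nonneg_left ?_ hpq
  calc O a ^ 2 = |O a| ^ 2 := (sq_abs _).symm
    _ ≤ B ^ 2 := pow_le_pow_left₀ (abs_nonneg _) (hOB a) 2

/-- **`Var_{q dμ}(w·O) ≤ B²·M₂`** (`≤ ∫ (wO)² d(q dμ) = ∫ (p²/q)·O² dμ ≤ B² ∫ p²/q dμ`). [ours] -/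
theorem variance_weightMul_model_le
    (hν : IsProbabilityMeasure (μ.withDensity fun z => ENNReal.ofReal (q z)))
    (hpm : Measurable p) (hq0 : ∀ z, 0 < q z) (hqm : Measurable q)
    (hM2i : Integrable (fun z => p z ^ 2 / q z) μ) (hOm : Measurable O) {B : ℝ}
    (hOB : ∀ z, |O z| ≤ B) :
    Var[fun a => p a / q a * O a; μ.withDensity fun z => ENNReal.ofReal (q z)]
      ≤ B ^ 2 * ∫ z, p z ^ 2 / q z ∂μ := by
  have hf2 := memLp_weightMul_model hpm hq0 hqm hM2i hOm hOB
  rw [variance_eq_sub hf2]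
  simp only [Pi.pow_apply]
  have h2 : ∫ a, (p a / q a * O a) ^ 2 ∂(μ.withDensity fun z => ENNReal.ofReal (q z))
      = ∫ z, p z ^ 2 / q z * O z ^ 2 ∂μ := by
    rw [AllPairsVariance.integral_withDensity_eq' (fun z => (hq0 z).le) hqm]
    refine integral_congr_ae (Filter.Eventually.of_forall fun a => ?_)
    show (p a / q a * O a) ^ 2 * q a = p a ^ 2 / q a * O a ^ 2
    field_simp [(hq0 a).ne']
  rw [h2]
  have hle : ∫ z, p z ^ 2 / q z * O z ^ 2 ∂μ ≤ ∫ z, p z ^ 2 / q z * B ^ 2 ∂μ := by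
    refine integral_mono_of_nonneg (Filter.Eventually.of_forall fun z =>
      mul_nonneg (div_nonneg (sq_nonneg _) (hq0 z).le) (sq_nonneg _)) (hM2i.mul_const _)
      (Filter.Eventually.of_forall fun z => ?_)
    refine mul_le_mul_of_nonneg_left ?_ (div_nonneg (sq_nonneg _) (hq0 z).le)
    calc O z ^ 2 = |O z| ^ 2 := (sq_abs _).symm
      _ ≤ B ^ 2 := pow_le_pow_left₀ (abs_nonneg _) (hOB z) 2
  rw [integral_mul_const] at hle
  nlinarith [sq_nonneg (∫ a, p a / q a * O a ∂(μ.withDensity fun z => ENNReal.ofReal (q z)))]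

/-- **THE REWEIGHTING COLUMN WITHOUT A CEILING.**  `n` independent model draws `y_j` (laws
`μ.withDensity q`), `q > 0` measurable, `p` measurable with `p²/q ∈ L¹(μ)` (`M₂ = ∫ p²/q dμ`), an
observable `O` measurable with `|O| ≤ B`; blocks of `m ≥ 1` draws, `R·m ≤ n`; `t > 0` with
`4B²M₂ ≤ m t²`.  With `Ê_r = Σ_{j<m} w(y_{rm+j}) O(y_{rm+j}) / m` (`w = p/q`):
`P( #{r < R : t ≤ |Ê_r − ∫ p·O dμ|} ≥ R/2 ) ≤ exp(−R/8)`. [ours] -/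
theorem reweighting_medianOfBlocks_confidence {y : Fin n → Ω → X} (hym : ∀ j, Measurable (y j))
    (hind : iIndepFun y P) (hpm : Measurable p) (hq0 : ∀ z, 0 < q z) (hqm : Measurable q)
    (hM2i : Integrable (fun z => p z ^ 2 / q z) μ) (hOm : Measurable O) {B : ℝ}
    (hOB : ∀ z, |O z| ≤ B)
    (hlaw : ∀ j, Measure.map (y j) P = μ.withDensity fun z => ENNReal.ofReal (q z))
    (hm : 1 ≤ m) (hRm : R * m ≤ n) {t : ℝ} (ht : 0 < t)
    (hvt : 4 * (B ^ 2 * ∫ z, p z ^ 2 / q z ∂μ) ≤ m * t ^ 2) :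
    P.real {ω | (R : ℝ) / 2 ≤ #{r ∈ (univ : Finset (Fin R)) | t ≤
        |(∑ j : Fin m, p (y ⟨((r : Fin R) : ℕ) * m + j, mul_add_lt hRm r j⟩ ω)
            / q (y ⟨((r : Fin R) : ℕ) * m + j, mul_add_lt hRm r j⟩ ω)
            * O (y ⟨((r : Fin R) : ℕ) * m + j, mul_add_lt hRm r j⟩ ω)) / m
          - ∫ z, p z * O z ∂μ|}} ≤ exp (-(R / 8)) := by
  rcases Nat.eq_zero_or_pos R with hR | hR
  · subst hR
    refine measureReal_le_one.trans ?_
    simp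
  have hn : 0 < n := by
    have : 0 < R * m := Nat.mul_pos hR (by omega)
    omega
  have hν : IsProbabilityMeasure (μ.withDensity fun z => ENNReal.ofReal (q z)) :=
    isProbabilityMeasure_of_map_eq_iid (hym ⟨0, hn⟩) (hlaw ⟨0, hn⟩)
  have h := blockMean_medianOfBlocks_confidence (ν := μ.withDensity fun z => ENNReal.ofReal (q z))
    (g := fun a => p a / q a * O a) hym hind hlaw ((hpm.div hqm).mul hOm)
    (memLp_weightMul_model hpm hq0 hqm hM2i hOm hOB) hm hRm ht
    ((mul_le_mul_of_nonneg_left (variance_weightMul_model_le hν hpm hq0 hqm hM2i hOm hOB)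
      (by norm_num)).trans hvt)
  rw [integral_weightMul_model hq0 hqm] at h
  exact h

/-- **THE REWEIGHTING COLUMN WITHOUT A CEILING, for ANY sample median** `med(ω)` of the `R` block
estimates: `4B²M₂ ≤ m t²` ⇒ `P(t ≤ |med − ∫ p·O dμ|) ≤ exp(−R/8)`. [ours] -/
theorem reweighting_sampleMedian_confidence {y : Fin n → Ω → X} (hym : ∀ j, Measurable (y j))
    (hind : iIndepFun y P) (hpm : Measurable p) (hq0 : ∀ z, 0 < q z) (hqm : Measurable q)
    (hM2i : Integrable (fun z => p z ^ 2 / q z) μ) (hOm : Measurable O) {B : ℝ}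
    (hOB : ∀ z, |O z| ≤ B)
    (hlaw : ∀ j, Measure.map (y j) P = μ.withDensity fun z => ENNReal.ofReal (q z))
    (hm : 1 ≤ m) (hRm : R * m ≤ n) {t : ℝ} (ht : 0 < t)
    (hvt : 4 * (B ^ 2 * ∫ z, p z ^ 2 / q z ∂μ) ≤ m * t ^ 2) {med : Ω → ℝ}
    (hlo : ∀ ω, (R : ℝ) / 2 ≤ #{r ∈ (univ : Finset (Fin R)) | med ω ≤
        (∑ j : Fin m, p (y ⟨((r : Fin R) : ℕ) * m + j, mul_add_lt hRm r j⟩ ω)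
            / q (y ⟨((r : Fin R) : ℕ) * m + j, mul_add_lt hRm r j⟩ ω)
            * O (y ⟨((r : Fin R) : ℕ) * m + j, mul_add_lt hRm r j⟩ ω)) / m})
    (hhi : ∀ ω, (R : ℝ) / 2 ≤ #{r ∈ (univ : Finset (Fin R)) |
        (∑ j : Fin m, p (y ⟨((r : Fin R) : ℕ) * m + j, mul_add_lt hRm r j⟩ ω)
            / q (y ⟨((r : Fin R) : ℕ) * m + j, mul_add_lt hRm r j⟩ ω)
            * O (y ⟨((r : Fin R) : ℕ) * m + j, mul_add_lt hRm r j⟩ ω)) / m ≤ med ω}) :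
    P.real {ω | t ≤ |med ω - ∫ z, p z * O z ∂μ|} ≤ exp (-(R / 8)) := by
  refine (measureReal_mono ?_).trans
    (reweighting_medianOfBlocks_confidence hym hind hpm hq0 hqm hM2i hOm hOB hlaw hm hRm ht hvt)
  intro ω hω
  simp only [Set.mem_setOf_eq] at hω ⊢
  by_contra hlt
  push Not at hlt
  have hR : (#(univ : Finset (Fin R)) : ℝ) = R := by rw [card_univ, Fintype.card_fin]
  have h := abs_median_sub_lt_of_card_lt (univ : Finset (Fin R)) _ (hR ▸ hlo ω) (hR ▸ hhi ω)
    (hR ▸ hlt)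
  linarith

end Reweighting

end Summit.Ventures.LatticeQCDFlow.Scoring.ReweightingMedian

end
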